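import Literature.Probability.LatticeModels.RandomClusterExploredWiring
import Literature.Probability.LatticeModels.RandomClusterFKG
import HarnessLib

/-!
# Domain Markov property of the FREE random-cluster measure when the rim of the region is wired from outside

Topic `Literature/Probability/LatticeModels` (trunk `StatMech`, family `crit-ising`). Companion of
`RandomClusterExploredWiring.lean`. There the exact conditional law of the configuration in an
unexplored region `U` given the configuration `ζ₀` off `U` is identified as `φ^W_{⟨U⟩}` when the
explored open edges all hang off the WIRED set `B ≠ ∅` of the measure. Here we prove the form needed
for decompositions at the outermost open circuit / crosscut of an annulus under a FREE measure
(H. Kesten, PTRF 73 (1986), proof of Thm. 3; Grimmett 2006, Lemma (4.13)): the measure is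
`φ^∅_{G,p,q}`, the region `U` lives on a vertex set `X` (both endpoints of every edge of `U` lie in
`X`), the open edges `ζ₀` off `U` touch `X` only at the RIM `W` (an endpoint in `X` of an edge of `ζ₀`
lies in `W`), and the rim is ONE `ζ₀`-cluster (any two vertices of `W` are joined by a `ζ₀`-open path —
"the circuit is wired from outside"). Far `ζ₀`-clusters not touching `X` are allowed; they contribute a
factor independent of the inside configuration. Then for every event `A` of the region,

  `φ^∅_{G,p,q}({ω ∩ U ∈ A} ∩ {ω ∖ U = ζ₀}) = φ^∅_{G,p,q}({ω ∖ U = ζ₀}) · φ^W_{⟨U⟩,p,q}(A)`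

(`rcMeasure_real_inter_cylinder_eq_mul_fromEdgeSet_rim`; `0 ≤ p ≤ 1`, `q > 0`).

The combinatorial heart is `clusterCount_union_add_eq`: for inside configurations `a ⊆ U`,
`k^∅(a ∪ ζ₀) + k^W(∅) = k^∅(ζ₀) + k^W(a)` — the difference `k^∅(a ∪ ζ₀) - k^W(a)` does not depend on
`a`, by induction on `a` one edge at a time: a new inside edge `uv` (`u, v ∈ X`) merges two clusters of
`⟨a⟩ ∨ ⟨ζ₀⟩` iff it merges two clusters of `⟨a⟩ ∨ K_W` (`reachable_sup_wired_iff`: an excursion of a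
path through outside-open edges leaves and re-enters `X` at rim vertices, which the wiring `K_W` joins
directly; conversely a `K_W`-jump is a `ζ₀`-path), and adding an edge lowers the number of components
by one exactly when its endpoints were not joined (`card_connectedComponent_sup_edge_*`,
`RandomClusterFKG.lean`). Everything is proved; no definitions, no named facts.

## References

* G. Grimmett, *The Random-Cluster Model*, Springer (2006): §4.2, eqs. (4.11)–(4.13), Lemma (4.13).
* H. Kesten, The incipient infinite cluster in two-dimensional percolation, *Probab. Theory Related
  Fields* 73 (1986) 369–394: proof of Thm. 3 (conditioning on the outermost open circuit).
-/

noncomputable section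

open MeasureTheory Finset SimpleGraph

namespace Literature.Probability.LatticeModels

/-! ### Reachability: outside-open excursions versus the wiring of the rim -/

section Reach

variable {V : Type*}

/-- **An outside excursion is a rim-to-rim jump.** Let the inside edges `a` have both endpoints in
`X`, and let every endpoint in `X` of an outside edge of `ξ` lie in the rim `W`. Then two vertices of
`X` joined in `⟨a⟩ ∨ ⟨ξ⟩` are joined in `⟨a⟩ ∨ K_W` (`K_W` the wiring of `W`): along a walk, each
maximal run of `ξ`-edges starts and ends at rim vertices. [cite: Grimmett2006, §4.2, Lemma (4.13)] -/
theorem reachable_sup_wired_of_reachable_sup_fromEdgeSet {a ξ : Set (Sym2 V)} {W X : Set V}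
    (haX : ∀ e ∈ a, ∀ x ∈ e, x ∈ X) (hξ : ∀ e ∈ ξ, ∀ x ∈ e, x ∈ X → x ∈ W)
    {u v : V} (hu : u ∈ X) (hv : v ∈ X) (h : (fromEdgeSet a ⊔ fromEdgeSet ξ).Reachable u v) :
    (fromEdgeSet a ⊔ wired W).Reachable u v := by
  obtain ⟨p⟩ := h
  have hKW : ∀ {s t : V}, s ∈ W → t ∈ W → (fromEdgeSet a ⊔ wired W).Reachable s t := by
    intro s t hs ht
    by_cases hst : s = t
    · subst hst; exact Reachable.refl _
    · exact Adj.reachable (Or.inr (by rw [wired_adj]; exact ⟨hst, hs, ht⟩))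
  -- invariant along a walk towards a vertex of `X`
  suffices H : ∀ {x y : V} (_ : (fromEdgeSet a ⊔ fromEdgeSet ξ).Walk x y), y ∈ X →
      (x ∈ X → (fromEdgeSet a ⊔ wired W).Reachable x y) ∧
      (x ∉ X → ∃ w ∈ W, (fromEdgeSet ξ).Reachable x w ∧ (fromEdgeSet a ⊔ wired W).Reachable w y) from
    (H p hv).1 hu
  intro x y q
  induction q with
  | nil => exact fun hy => ⟨fun _ => Reachable.refl _, fun hx => absurd hy hx⟩
  | @cons x x₁ z hxx₁ q ih =>
    intro hz
    have ih := ih hz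
    rw [sup_adj] at hxx₁
    rcases hxx₁ with hA | hΞ
    · -- an inside edge: both endpoints in `X`
      have hmem := ((fromEdgeSet_adj _).1 hA).1
      have hx : x ∈ X := haX _ hmem x (Sym2.mem_mk_left x x₁)
      have hx₁ : x₁ ∈ X := haX _ hmem x₁ (Sym2.mem_mk_right x x₁)
      refine ⟨fun _ => ?_, fun hx' => absurd hx hx'⟩
      have h1 : (fromEdgeSet a ⊔ wired W).Adj x x₁ := Or.inl hA
      exact h1.reachable.trans (ih.1 hx₁)
    · -- an outside edge: its endpoints in `X` are rim vertices
      have hmem := ((fromEdgeSet_adj _).1 hΞ).1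
      have hxW : x ∈ X → x ∈ W := hξ _ hmem x (Sym2.mem_mk_left x x₁)
      have hx₁W : x₁ ∈ X → x₁ ∈ W := hξ _ hmem x₁ (Sym2.mem_mk_right x x₁)
      have hξxx₁ : (fromEdgeSet ξ).Reachable x x₁ := hΞ.reachable
      by_cases hx₁ : x₁ ∈ X
      · have ih1 := ih.1 hx₁
        refine ⟨fun hx => (hKW (hxW hx) (hx₁W hx₁)).trans ih1, fun _ => ⟨x₁, hx₁W hx₁, hξxx₁, ih1⟩⟩
      · obtain ⟨w, hw, hx₁w, hwv⟩ := ih.2 hx₁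
        exact ⟨fun hx => (hKW (hxW hx) hw).trans hwv, fun _ => ⟨w, hw, hξxx₁.trans hx₁w, hwv⟩⟩

/-- **A rim jump is an outside excursion.** If any two rim vertices are joined by a `ξ`-open path,
then `⟨a⟩ ∨ K_W`-reachability implies `⟨a⟩ ∨ ⟨ξ⟩`-reachability. [cite: Grimmett2006, §4.2, Lemma (4.13)] -/
theorem reachable_sup_fromEdgeSet_of_reachable_sup_wired {a ξ : Set (Sym2 V)} {W : Set V}
    (hW : ∀ x ∈ W, ∀ y ∈ W, (fromEdgeSet ξ).Reachable x y)
    {u v : V} (h : (fromEdgeSet a ⊔ wired W).Reachable u v) :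
    (fromEdgeSet a ⊔ fromEdgeSet ξ).Reachable u v := by
  refine reachable_of_adj_imp_reachable (fun s t hst => ?_) h
  rcases hst with hst | hst
  · exact Adj.reachable (Or.inl hst : (fromEdgeSet a ⊔ fromEdgeSet ξ).Adj s t)
  · rw [wired_adj] at hst
    obtain ⟨-, hs, ht⟩ := hst
    exact (hW s hs t ht).mono le_sup_right

/-- The two reachability relations agree on `X`. [cite: Grimmett2006, §4.2, Lemma (4.13)] -/
theorem reachable_sup_wired_iff {a ξ : Set (Sym2 V)} {W X : Set V}
    (haX : ∀ e ∈ a, ∀ x ∈ e, x ∈ X) (hξ : ∀ e ∈ ξ, ∀ x ∈ e, x ∈ X → x ∈ W)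
    (hW : ∀ x ∈ W, ∀ y ∈ W, (fromEdgeSet ξ).Reachable x y)
    {u v : V} (hu : u ∈ X) (hv : v ∈ X) :
    (fromEdgeSet a ⊔ fromEdgeSet ξ).Reachable u v ↔ (fromEdgeSet a ⊔ wired W).Reachable u v :=
  ⟨reachable_sup_wired_of_reachable_sup_fromEdgeSet haX hξ hu hv,
    reachable_sup_fromEdgeSet_of_reachable_sup_wired hW⟩

end Reach

/-! ### The cluster-count identity -/

section ClusterCount

variable {V : Type*} [Finite V]

/-- **Cluster counts with the rim wired from outside.** For inside edges `a` on `X`, outside open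
edges `ξ` touching `X` only at the rim `W`, and `W` one `ξ`-cluster:
`k^∅(a ∪ ξ) + k^W(∅) = k^∅(ξ) + k^W(a)`, i.e. `k^∅(a ∪ ξ) - k^W(a)` does not depend on `a`
(induction on `a`: a new inside edge merges two clusters on the left iff it does on the right,
`reachable_sup_wired_iff`). [cite: Grimmett2006, §4.2, Lemma (4.13)] -/
theorem clusterCount_union_add_eq (a : Finset (Sym2 V)) (ξ : Set (Sym2 V)) {W X : Set V}
    (haX : ∀ e ∈ a, ∀ x ∈ e, x ∈ X) (hξ : ∀ e ∈ ξ, ∀ x ∈ e, x ∈ X → x ∈ W)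
    (hW : ∀ x ∈ W, ∀ y ∈ W, (fromEdgeSet ξ).Reachable x y) :
    clusterCount ((↑a : Set (Sym2 V)) ∪ ξ) ∅ + clusterCount (∅ : Percolation.BondConfig V) W =
      clusterCount ξ ∅ + clusterCount (↑a : Percolation.BondConfig V) W := by
  classical
  induction a using Finset.induction_on with
  | empty => simp [clusterCount, Percolation.openGraph]
  | insert e a hea ih =>
    have haX' : ∀ e ∈ a, ∀ x ∈ e, x ∈ X := fun e' he' => haX e' (Finset.mem_insert_of_mem he')
    have ih' := ih haX'
    induction e using Sym2.ind with
    | h u v =>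
      have hu : u ∈ X := haX _ (Finset.mem_insert_self _ _) u (Sym2.mem_mk_left u v)
      have hv : v ∈ X := haX _ (Finset.mem_insert_self _ _) v (Sym2.mem_mk_right u v)
      -- the graphs after inserting the edge `uv`
      have h1 : fromEdgeSet ((↑(insert s(u, v) a) : Set (Sym2 V)) ∪ ξ) ⊔ wired (∅ : Set V) =
          (fromEdgeSet (↑a : Set (Sym2 V)) ⊔ fromEdgeSet ξ) ⊔ edge u v := by
        rw [wired_empty, sup_bot_eq, Finset.coe_insert, Set.insert_union, Set.insert_eq,
          fromEdgeSet_union, fromEdgeSet_union, sup_comm]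
        rfl
      have h0 : fromEdgeSet ((↑a : Set (Sym2 V)) ∪ ξ) ⊔ wired (∅ : Set V) =
          fromEdgeSet (↑a : Set (Sym2 V)) ⊔ fromEdgeSet ξ := by
        rw [wired_empty, sup_bot_eq, fromEdgeSet_union]
      have h2 : fromEdgeSet (↑(insert s(u, v) a) : Set (Sym2 V)) ⊔ wired W =
          (fromEdgeSet (↑a : Set (Sym2 V)) ⊔ wired W) ⊔ edge u v := by
        rw [Finset.coe_insert, Set.insert_eq, fromEdgeSet_union, sup_comm (fromEdgeSet {s(u, v)}),
          sup_right_comm]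
        rfl
      unfold clusterCount Percolation.openGraph at ih' ⊢
      rw [h1, h2]
      rw [h0] at ih'
      set K₁ : SimpleGraph V := fromEdgeSet (↑a : Set (Sym2 V)) ⊔ fromEdgeSet ξ with hK₁
      set K₂ : SimpleGraph V := fromEdgeSet (↑a : Set (Sym2 V)) ⊔ wired W with hK₂
      have hiff : K₁.Reachable u v ↔ K₂.Reachable u v :=
        reachable_sup_wired_iff (fun e' he' => haX' e' (Finset.mem_coe.1 he')) hξ hW hu hv
      by_cases huv : K₁.Reachable u v
      · rw [card_connectedComponent_sup_edge_of_reachable K₁ huv,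
          card_connectedComponent_sup_edge_of_reachable K₂ (hiff.1 huv)]
        exact ih'
      · have huv' : ¬K₂.Reachable u v := fun h => huv (hiff.2 h)
        have l1 := card_connectedComponent_sup_edge_lt K₁ huv
        have l1' := card_connectedComponent_le_sup_edge_add_one K₁ u v
        have l2 := card_connectedComponent_sup_edge_lt K₂ huv'
        have l2' := card_connectedComponent_le_sup_edge_add_one K₂ u v
        omega

end ClusterCount

/-! ### Weights and the exact conditional law -/

section Finite

variable {V : Type*} [Fintype V] [DecidableEq V] (G : SimpleGraph V) [DecidableRel G.Adj]

/-- **Weights factorise when the rim is wired from outside.** For a region `U ⊆ E(G)` on the vertex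
set `X`, a configuration `ζ₀ ⊆ E(G) ∖ U` touching `X` only at the rim `W`, `W` one `ζ₀`-cluster, and
`η ⊆ U`:
`w^∅_G(η ∪ ζ₀) · q^{k^W(∅)} = p^{|ζ₀|} (1 - p)^{|E(G) ∖ U| - |ζ₀|} q^{k^∅(ζ₀)} · w^W_{⟨U⟩}(η)`.
[cite: Grimmett2006, §4.2 eq. (4.12) and Lemma (4.13)] -/
theorem rcWeight_union_mul_eq_mul_rcWeight_fromEdgeSet_rim (p q : ℝ) {W X : Set V}
    {U ζ₀ η : Finset (Sym2 V)} (hU : U ⊆ G.edgeFinset) (hζ₀ : ζ₀ ⊆ G.edgeFinset \ U) (hη : η ⊆ U)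
    (hUX : ∀ e ∈ U, ∀ x ∈ e, x ∈ X) (hζX : ∀ e ∈ ζ₀, ∀ x ∈ e, x ∈ X → x ∈ W)
    (hW : ∀ x ∈ W, ∀ y ∈ W, (fromEdgeSet (ζ₀ : Set (Sym2 V))).Reachable x y) :
    rcWeight G p q ∅ (η ∪ ζ₀) * q ^ clusterCount (∅ : Percolation.BondConfig V) W =
      p ^ #ζ₀ * (1 - p) ^ (#(G.edgeFinset \ U) - #ζ₀) *
        q ^ clusterCount (↑ζ₀ : Percolation.BondConfig V) ∅ *
        rcWeight (fromEdgeSet (U : Set (Sym2 V))) p q W η := by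
  have hEU : ∀ i : Fintype (fromEdgeSet (U : Set (Sym2 V))).edgeSet,
      @SimpleGraph.edgeFinset V (fromEdgeSet (U : Set (Sym2 V))) i = U := fun i ↦
    @edgeFinset_fromEdgeSet_of_subset V _ G _ U hU i
  have hζ₀U : Disjoint ζ₀ U := Finset.disjoint_of_subset_left hζ₀ sdiff_disjoint
  have hηζ : Disjoint η ζ₀ := Finset.disjoint_of_subset_left hη hζ₀U.symm
  -- cardinalities
  have hcard₁ : #(η ∪ ζ₀) = #η + #ζ₀ := card_union_of_disjoint hηζ
  have hsplit : G.edgeFinset \ (η ∪ ζ₀) = (U \ η) ∪ ((G.edgeFinset \ U) \ ζ₀) := by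
    ext e
    simp only [mem_sdiff, mem_union, not_or]
    constructor
    · rintro ⟨heE, heη, heζ⟩
      by_cases heU : e ∈ U
      · exact Or.inl ⟨heU, heη⟩
      · exact Or.inr ⟨⟨heE, heU⟩, heζ⟩
    · rintro (⟨heU, heη⟩ | ⟨⟨heE, heU⟩, heζ⟩)
      · exact ⟨hU heU, heη, fun h ↦ (Finset.disjoint_left.1 hζ₀U h) heU⟩
      · exact ⟨heE, fun h ↦ heU (hη h), heζ⟩
  have hdisj : Disjoint (U \ η) ((G.edgeFinset \ U) \ ζ₀) :=
    Finset.disjoint_of_subset_left sdiff_subset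
      (Finset.disjoint_of_subset_right sdiff_subset disjoint_sdiff)
  have hcard₂ : #(G.edgeFinset \ (η ∪ ζ₀)) = #(U \ η) + (#(G.edgeFinset \ U) - #ζ₀) := by
    rw [hsplit, card_union_of_disjoint hdisj, card_sdiff_of_subset hζ₀]
  -- cluster counts
  have hk : clusterCount (↑(η ∪ ζ₀) : Percolation.BondConfig V) ∅ +
      clusterCount (∅ : Percolation.BondConfig V) W =
      clusterCount (↑ζ₀ : Percolation.BondConfig V) ∅ + clusterCount (↑η : Percolation.BondConfig V) W := by
    rw [Finset.coe_union]
    exact clusterCount_union_add_eq η (↑ζ₀) (fun e he ↦ hUX e (hη he))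
      (fun e he x hx ↦ hζX e (Finset.mem_coe.1 he) x hx) hW
  have hq : q ^ clusterCount (↑(η ∪ ζ₀) : Percolation.BondConfig V) ∅ *
      q ^ clusterCount (∅ : Percolation.BondConfig V) W =
      q ^ clusterCount (↑ζ₀ : Percolation.BondConfig V) ∅ *
        q ^ clusterCount (↑η : Percolation.BondConfig V) W := by
    rw [← pow_add, ← pow_add, hk]
  simp only [rcWeight, hEU, hcard₁, hcard₂, pow_add]
  calc p ^ #η * p ^ #ζ₀ * ((1 - p) ^ #(U \ η) * (1 - p) ^ (#(G.edgeFinset \ U) - #ζ₀)) *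
        q ^ clusterCount (↑(η ∪ ζ₀) : Percolation.BondConfig V) ∅ *
        q ^ clusterCount (∅ : Percolation.BondConfig V) W
      = p ^ #η * p ^ #ζ₀ * ((1 - p) ^ #(U \ η) * (1 - p) ^ (#(G.edgeFinset \ U) - #ζ₀)) *
        (q ^ clusterCount (↑(η ∪ ζ₀) : Percolation.BondConfig V) ∅ *
        q ^ clusterCount (∅ : Percolation.BondConfig V) W) := by ring
    _ = p ^ #η * p ^ #ζ₀ * ((1 - p) ^ #(U \ η) * (1 - p) ^ (#(G.edgeFinset \ U) - #ζ₀)) *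
        (q ^ clusterCount (↑ζ₀ : Percolation.BondConfig V) ∅ *
        q ^ clusterCount (↑η : Percolation.BondConfig V) W) := by rw [hq]
    _ = _ := by ring

/-- **Domain Markov property of the free random-cluster measure when the rim is wired from
outside, exact form** (Grimmett 2006, Lemma (4.13); Kesten 1986, proof of Thm. 3: "conditionally on
the outermost open circuit `Γ` and on everything outside it, the configuration inside `Γ` is the
random-cluster configuration of the interior with `Γ` wired"). Let `U ⊆ E(G)` be a region all of
whose edges have both endpoints in `X`, `ζ₀ ⊆ E(G) ∖ U` a configuration off the region whose edges
touch `X` only at vertices of the rim `W`, and suppose any two vertices of `W` are joined by a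
`ζ₀`-open path. Then for EVERY event `A`,
`φ^∅_{G,p,q}({ω ∩ U ∈ A} ∩ {ω ∖ U = ζ₀}) = φ^∅_{G,p,q}({ω ∖ U = ζ₀}) · φ^W_{⟨U⟩,p,q}(A)`
(`0 ≤ p ≤ 1`, `q > 0`). [cite: Grimmett2006, Lemma (4.13)] -/
theorem rcMeasure_real_inter_cylinder_eq_mul_fromEdgeSet_rim {p q : ℝ}
    (hp : p ∈ Set.Icc (0 : ℝ) 1) (hq : 0 < q) {W X : Set V} (U : Finset (Sym2 V))
    (hU : U ⊆ G.edgeFinset) {ζ₀ : Finset (Sym2 V)} (hζ₀ : ζ₀ ⊆ G.edgeFinset \ U)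
    (hUX : ∀ e ∈ U, ∀ x ∈ e, x ∈ X) (hζX : ∀ e ∈ ζ₀, ∀ x ∈ e, x ∈ X → x ∈ W)
    (hW : ∀ x ∈ W, ∀ y ∈ W, (fromEdgeSet (ζ₀ : Set (Sym2 V))).Reachable x y)
    (A : Set (Percolation.BondConfig V)) :
    (rcMeasure G p q ∅).real ({ω | ω ∩ ↑U ∈ A} ∩ {ω | ω ∩ (↑U : Set (Sym2 V))ᶜ = ↑ζ₀}) =
      (rcMeasure G p q ∅).real {ω | ω ∩ (↑U : Set (Sym2 V))ᶜ = ↑ζ₀} *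
        (rcMeasure (fromEdgeSet (U : Set (Sym2 V))) p q W).real A := by
  classical
  have hZ := rcPartitionFunction_pos G hp hq (∅ : Set V)
  set GU : SimpleGraph V := fromEdgeSet (U : Set (Sym2 V)) with hGU
  have hEU : ∀ i : Fintype GU.edgeSet, @SimpleGraph.edgeFinset V GU i = U := fun i ↦
    @edgeFinset_fromEdgeSet_of_subset V _ G _ U hU i
  haveI : IsProbabilityMeasure (rcMeasure GU p q W) := isProbabilityMeasure_rcMeasure GU hp hq W
  have hqW : 0 < q ^ clusterCount (∅ : Percolation.BondConfig V) W := pow_pos hq _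
  set c : ℝ := p ^ #ζ₀ * (1 - p) ^ (#(G.edgeFinset \ U) - #ζ₀) *
    q ^ clusterCount (↑ζ₀ : Percolation.BondConfig V) ∅ /
    q ^ clusterCount (∅ : Percolation.BondConfig V) W with hc
  have hweight : ∀ η : Finset (Sym2 V), η ⊆ U →
      rcWeight G p q ∅ (η ∪ ζ₀) = c * rcWeight GU p q W η := by
    intro η hη
    have h := rcWeight_union_mul_eq_mul_rcWeight_fromEdgeSet_rim G p q hU hζ₀ hη hUX hζX hW
    rw [hc]
    field_simp
    linarith [h]
  -- `Z_G φ_G({ω ∩ U ∈ A'} ∩ {ω ∖ U = ζ₀}) = c · Z^W_U φ^W_U(A')`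
  have key : ∀ A' : Set (Percolation.BondConfig V), rcPartitionFunction G p q ∅ *
      (rcMeasure G p q ∅).real ({ω | ω ∩ ↑U ∈ A'} ∩ {ω | ω ∩ (↑U : Set (Sym2 V))ᶜ = ↑ζ₀}) =
      c * (rcPartitionFunction GU p q W * (rcMeasure GU p q W).real A') := by
    intro A'
    rw [rcPartitionFunction_mul_real_inter_cylinder G hp hq ∅ hU hζ₀ A']
    have h2 : rcPartitionFunction GU p q W * (rcMeasure GU p q W).real A' =
        ∑ η ∈ U.powerset, rcWeight GU p q W η *
          (if (↑η : Percolation.BondConfig V) ∈ A' then 1 else 0) := by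
      rw [rcMeasure_real_apply GU hp hq W A', Finset.mul_sum, hEU]
      refine Finset.sum_congr rfl fun η _ ↦ ?_
      have hZU := (rcPartitionFunction_pos GU hp hq W).ne'
      split_ifs
      · field_simp
      · simp
    rw [h2, Finset.mul_sum]
    refine Finset.sum_congr rfl fun η hη ↦ ?_
    rw [hweight η (Finset.mem_powerset.1 hη)]
    ring
  have k1 := key A
  have k2 := key Set.univ
  simp only [Set.mem_univ, Set.setOf_true, Set.univ_inter, probReal_univ, mul_one] at k2
  apply mul_left_cancel₀ hZ.ne'
  rw [k1, ← mul_assoc (rcPartitionFunction G p q ∅), k2]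
  ring

end Finite

end Literature.Probability.LatticeModels

end
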